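import Literature.Barriers.Schanuel.NesterenkoModularScopeRamanujanProofs
import HarnessLib

/-!
# Barrier (Schanuel) `NesterenkoModularScope`: quasi-modularity of `E₂` (`∂₁E₂ = −E₄/12`, i.e. `12θP = P² − Q`) and Ramanujan's system (2) DISCHARGED (proofs only)

`Literature/Barriers/Schanuel/NesterenkoModularScopeRamanujanSystemProofs.lean` — third sibling proofs
file for the named fact `ramanujan1916_system` of `NesterenkoModularScopeSeries.lean` (Nesterenko–
Philippon (eds.), LNM 1752, Ch. 3 §1 (2), p. 27: "`DP = (P² − Q)/12`, `DQ = (PQ − R)/3`,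
`DR = (PR − Q²)/2`, `D = z d/dz`", Ramanujan 1916), which it DISCHARGES:
`ramanujan1916_system_holds`. No new definitions.

Content: the first identity `12θP = P² − Q` over `ℂ` (`ramanujan_P_identity_complex`) — the
function `∂₁E₂ = DE₂ − E₂²/12` has an explicit `q`-series (coefficients of `θP − P²/12`), is
bounded at `i∞`, and is invariant of weight `4` under `SL(2, ℤ)`: under `T` by periodicity, under
`S` by the anomaly of `E₂`, `E₂|₂S = E₂ − φ`, `φ = (2ζ(2))⁻¹·2πi/z = 6i/(πz)` (Mathlib's
`E2_slash_action`), the equivariance `∂₂(E₂|₂S) = (∂₂E₂)|₄S` (`serreDerivative_slash_equivariant`)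
and the computation `Dφ = φ²/12` (`serreDerivative_one_E2_slash_S`); hence it is a level one
modular form of weight `4`, a multiple of `E₄` (`dim M₄ = 1`), the multiple `−1/12` being read off
the constant term, and `ModularFormClass.qExpansion_coeff_unique` gives the identity of all
`q`-coefficients (cf. LNM 1752 Ch. 1 §1 (1): `Df(−1/τ) = τ^{k+2}Df(τ) + kτ^{k+1}f(τ)/2πi`, the
obstruction that the Serre derivative removes). Then the three identities over `ℂ` (this file and
`NesterenkoModularScopeRamanujanProofs.lean`) descend to `ℤ⟦X⟧` along the injective coefficient
map. Also recorded: `serreDerivative_E₂_eq` (`∂₁E₂ = −E₄/12` as functions on `ℍ`).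

## References

* [NesterenkoPhilippon2001] LNM 1752 (2001), Ch. 3 §1 (2) (p. 27); Ch. 10 (45); Ch. 1 §1 (1) (p. 2).
* S. Ramanujan, *On certain arithmetical functions*, Trans. Cambridge Phil. Soc. 22 (1916) 159–184.
-/

noncomputable section

open UpperHalfPlane hiding I
open Complex Filter Topology ModularForm EisensteinSeries Derivative
open scoped Real MatrixGroups CongruenceSubgroup ArithmeticFunction.sigma Manifold

namespace Literature.Barriers.Schanuel

/-! ### `∂₁E₂` (quasi-modularity of `E₂`) and the identity `12θP = P² − Q` -/

/-- The `q`-series of `∂₁E₂ = D E₂ − (1/12) E₂²`: coefficients of `θP − (1/12) P²`. [folklore] -/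
theorem hasSum_serreDerivative_E₂ (τ : ℍ) :
    HasSum (fun m : ℕ => PowerSeries.coeff m
      (ramanujanTheta (PowerSeries.map (Int.castRingHom ℂ) ramanujanPSeries)
          - PowerSeries.C (1 * 12⁻¹ : ℂ)
          * ((PowerSeries.map (Int.castRingHom ℂ) ramanujanPSeries) *
          (PowerSeries.map (Int.castRingHom ℂ) ramanujanPSeries))) *
        cexp (2 * π * Complex.I * τ) ^ m) (serreDerivative 1 E2 τ) := by
  have h1 := hasSum_normalizedDeriv_qSeries norm_coeff_P_le hasSum_E₂ τ
  have h2 := hasSum_mul_qSeries norm_coeff_P_le norm_coeff_P_le hasSum_E₂ hasSum_E₂ τ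
  have h3 := h1.sub (h2.mul_left (1 * 12⁻¹ : ℂ))
  have hPP : (PowerSeries.mk fun m => PowerSeries.coeff m
      (PowerSeries.map (Int.castRingHom ℂ) ramanujanPSeries)) *
      (PowerSeries.mk fun m => PowerSeries.coeff m
          (PowerSeries.map (Int.castRingHom ℂ) ramanujanPSeries)) =
          (PowerSeries.map (Int.castRingHom ℂ) ramanujanPSeries) *
          (PowerSeries.map (Int.castRingHom ℂ) ramanujanPSeries) := by
    congr 1 <;> ext n <;> simp
  have hfun : (fun m : ℕ => PowerSeries.coeff m
      (ramanujanTheta (PowerSeries.map (Int.castRingHom ℂ) ramanujanPSeries)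
          - PowerSeries.C (1 * 12⁻¹ : ℂ)
          * ((PowerSeries.map (Int.castRingHom ℂ) ramanujanPSeries) *
          (PowerSeries.map (Int.castRingHom ℂ) ramanujanPSeries)))
          * cexp (2 * π * Complex.I * τ) ^ m) =
      fun m : ℕ => ((m : ℂ) * PowerSeries.coeff m
          (PowerSeries.map (Int.castRingHom ℂ) ramanujanPSeries))
          * cexp (2 * π * Complex.I * τ) ^ m -
        1 * 12⁻¹ * (PowerSeries.coeff m ((PowerSeries.mk fun m => PowerSeries.coeff m
            (PowerSeries.map (Int.castRingHom ℂ) ramanujanPSeries)) *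
          (PowerSeries.mk fun m => PowerSeries.coeff m
              (PowerSeries.map (Int.castRingHom ℂ) ramanujanPSeries)))
              * cexp (2 * π * Complex.I * τ) ^ m) := by
    funext m
    rw [hPP, map_sub, coeff_ramanujanTheta, PowerSeries.coeff_C_mul]
    ring
  have hval : serreDerivative 1 E2 τ =
      normalizedDerivOfComplex E2 τ - 1 * 12⁻¹ * (E2 τ * E2 τ) := by
    rw [serreDerivative_apply]; ring
  rw [hfun, hval]
  exact h3

/-- `∂₁E₂` is bounded at `i∞`. [folklore] -/
theorem isBoundedAtImInfty_serreDerivative_E₂ : IsBoundedAtImInfty (serreDerivative 1 E2) :=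
  isBoundedAtImInfty_of_hasSum_qExpansion one_pos fun τ => by
    simpa only [Function.Periodic.qParam, ofReal_one, div_one, smul_eq_mul]
      using hasSum_serreDerivative_E₂ τ

/-- `∂₁E₂ = ∂₂E₂ + E₂²/12`. [folklore] -/
theorem serreDerivative_one_E2_eq :
    serreDerivative 1 E2 = serreDerivative 2 E2 + (12⁻¹ : ℂ) • (E2 * E2) := by
  funext z
  simp only [serreDerivative_apply, Pi.add_apply, Pi.smul_apply, Pi.mul_apply, smul_eq_mul]
  ring

/-- `∂₁E₂` is invariant of weight `4` under `T` (`E₂` is `1`-periodic: `D₂(T) = 0`). [folklore] -/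
theorem serreDerivative_one_E2_slash_T :
    serreDerivative 1 E2 ∣[(4 : ℤ)] ModularGroup.T = serreDerivative 1 E2 := by
  have hE2T : E2 ∣[(2 : ℤ)] ModularGroup.T = E2 := by
    rw [E2_slash_action, D2_T, smul_zero, sub_zero]
  have hequiv := serreDerivative_slash_equivariant (k := 2) E2_mdifferentiable (γ := ModularGroup.T)
  simp only [Int.cast_ofNat] at hequiv
  rw [serreDerivative_one_E2_eq, SlashAction.add_slash, SL_smul_slash,
    show (4 : ℤ) = 2 + 2 by norm_num, mul_slash_SL2, hequiv, hE2T]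

/-- **`∂₁E₂` is invariant of weight `4` under `S`.** With `φ = (2ζ(2))⁻¹ D₂(S) = 6i/(πz)` one has
`E₂|₂S = E₂ − φ` (Mathlib's `E2_slash_action`), so by equivariance of `∂₂`
(`serreDerivative_slash_equivariant`) `∂₁E₂|₄S = ∂₂(E₂ − φ) + (E₂ − φ)²/12 = ∂₁E₂ − Dφ + φ²/12`, and
`Dφ = φ²/12` (`D(6i/(πz)) = −3/(π²z²) = (6i/(πz))²/12`). This is the quasi-modularity of `E₂`
(cf. the weight-`k+2` obstruction (1) of the source for `Df`).
[cite: NesterenkoPhilippon2001, Ch. 1 §1 (1) (p. 2)] -/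
theorem serreDerivative_one_E2_slash_S :
    serreDerivative 1 E2 ∣[(4 : ℤ)] ModularGroup.S = serreDerivative 1 E2 := by
  set φ : ℍ → ℂ := (1 / (2 * riemannZeta 2)) • D2 ModularGroup.S with hφ
  have hE2S : E2 ∣[(2 : ℤ)] ModularGroup.S = E2 - φ := E2_slash_action _
  have hφm : MDiff φ := mdifferentiable_D2_S.const_smul _
  have hequiv := serreDerivative_slash_equivariant (k := 2) E2_mdifferentiable (γ := ModularGroup.S)
  simp only [Int.cast_ofNat] at hequiv
  rw [serreDerivative_one_E2_eq, SlashAction.add_slash, SL_smul_slash,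
    show (4 : ℤ) = 2 + 2 by norm_num, mul_slash_SL2, hequiv, hE2S,
    serreDerivative_sub 2 E2 φ E2_mdifferentiable hφm]
  -- the key computation `D φ = φ²/12`
  have hDφ : ∀ z : ℍ, normalizedDerivOfComplex φ z = 12⁻¹ * φ z * φ z := by
    intro z
    have hz : (z : ℂ) ≠ 0 := ne_zero z
    set c : ℂ := 1 / (2 * riemannZeta 2) with hc
    have heq : (φ ∘ ofComplex) =ᶠ[𝓝 (z : ℂ)] fun w => c * (2 * π * Complex.I) * w⁻¹ := by
      filter_upwards [isOpen_upperHalfPlaneSet.mem_nhds z.im_pos] with w hw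
      have hw' : 0 < w.im := hw
      simp only [Function.comp_apply, ofComplex_apply_of_im_pos hw', hφ, Pi.smul_apply,
        smul_eq_mul, D2_S]
      ring
    have hderiv : deriv (fun w : ℂ => c * (2 * π * Complex.I) * w⁻¹) z =
        c * (2 * π * Complex.I) * (-(((z : ℂ)) ^ 2)⁻¹) :=
      ((hasDerivAt_inv hz).const_mul (c * (2 * π * Complex.I))).deriv
    have hφz : φ z = c * (2 * π * Complex.I / z) := by
      simp only [hφ, Pi.smul_apply, smul_eq_mul, D2_S]
    rw [normalizedDerivOfComplex, heq.deriv_eq, hderiv, hφz, hc, riemannZeta_two]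
    have hπ : (π : ℂ) ≠ 0 := by exact_mod_cast Real.pi_ne_zero
    have hI2 : Complex.I ^ 2 = -1 := Complex.I_sq
    field_simp
    linear_combination (-12 : ℂ) * hI2
  funext z
  simp only [serreDerivative_apply, Pi.add_apply, Pi.sub_apply, Pi.smul_apply, Pi.mul_apply,
    smul_eq_mul, hDφ z]
  ring

/-- `∂₁E₂` is invariant of weight `4` under `SL(2, ℤ)` (generators `S, T`). [folklore] -/
theorem serreDerivative_one_E2_slash (γ : SL(2, ℤ)) :
    serreDerivative 1 E2 ∣[(4 : ℤ)] γ = serreDerivative 1 E2 :=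
  SlashInvariantForm.slash_action_generators_SL2Z serreDerivative_one_E2_slash_S
    serreDerivative_one_E2_slash_T γ

/-- `∂₁E₂` is a modular form of weight `4` and level `1`. [folklore] -/
theorem exists_modularForm_serreDerivative_E₂ :
    ∃ F : ModularForm 𝒮ℒ 4, ⇑F = serreDerivative 1 E2 := by
  refine ⟨{ toFun := serreDerivative 1 E2
            slash_action_eq' := fun A hA => ?_
            holo' := serreDerivative_mdifferentiable 1 E2_mdifferentiable
            bdd_at_cusps' := fun {c} hc => ?_ }, rfl⟩
  · obtain ⟨A, rfl⟩ := hA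
    exact serreDerivative_one_E2_slash A
  · rw [Subgroup.IsArithmetic.isCusp_iff_isCusp_SL2Z] at hc
    rw [OnePoint.isBoundedAt_iff_forall_SL2Z hc]
    intro γ _
    rw [serreDerivative_one_E2_slash γ]
    exact isBoundedAtImInfty_serreDerivative_E₂

/-- **Ramanujan's first identity over `ℂ`: `12θP = P² − Q`.** The modular form `∂₁E₂` of weight
`4` is a multiple of `E₄` (`dim M₄ = 1`); constant terms give `−1/12`, all `q`-coefficients give the
identity. [cite: NesterenkoPhilippon2001, Ch. 3 §1 (2) (DP = (P² − Q)/12, p. 27)] -/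
theorem ramanujan_P_identity_complex :
    (12 : PowerSeries ℂ) * ramanujanTheta (PowerSeries.map (Int.castRingHom ℂ) ramanujanPSeries)
        = (PowerSeries.map (Int.castRingHom ℂ) ramanujanPSeries) *
        (PowerSeries.map (Int.castRingHom ℂ) ramanujanPSeries) -
        (PowerSeries.map (Int.castRingHom ℂ) ramanujanQSeries) := by
  obtain ⟨F, hF⟩ := exists_modularForm_serreDerivative_E₂
  obtain ⟨c, hc⟩ : ∃ c : ℂ, c • E₄ = F :=
    (finrank_eq_one_iff_of_nonzero' E₄ (E_ne_zero _ ⟨2, rfl⟩)).mp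
      (Module.rank_eq_one_iff_finrank_eq_one.mp levelOne_weight_four_rank_one) F
  set S : PowerSeries ℂ := ramanujanTheta (PowerSeries.map (Int.castRingHom ℂ) ramanujanPSeries)
      - PowerSeries.C (1 * 12⁻¹ : ℂ) * ((PowerSeries.map (Int.castRingHom ℂ) ramanujanPSeries)
      * (PowerSeries.map (Int.castRingHom ℂ) ramanujanPSeries)) with hS
  have hcoefF : ∀ m, PowerSeries.coeff m S = (qExpansion 1 F).coeff m := fun m => by
    refine ModularFormClass.qExpansion_coeff_unique one_pos one_mem_strictPeriods_SL (f := F)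
      (c := fun m => PowerSeries.coeff m S) (fun τ => ?_) m
    rw [hF]
    simpa only [Function.Periodic.qParam, ofReal_one, div_one, smul_eq_mul]
      using hasSum_serreDerivative_E₂ τ
  have hqF : qExpansion 1 (F : ℍ → ℂ) = c • qExpansion 1 (E₄ : ℍ → ℂ) := by
    rw [← hc]
    exact ModularForm.qExpansion_smul one_pos one_mem_strictPeriods_SL c E₄
  have hcoef : ∀ m, PowerSeries.coeff m S = c * PowerSeries.coeff m
      (PowerSeries.map (Int.castRingHom ℂ) ramanujanQSeries) := fun m => by
    rw [hcoefF m, hqF, PowerSeries.coeff_smul, qExpansion_E₄_coeff, smul_eq_mul]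
  have hP0 : PowerSeries.coeff 0 (PowerSeries.map (Int.castRingHom ℂ) ramanujanPSeries) = 1 := by
    rw [PowerSeries.coeff_map, coeff_ramanujanPSeries]; simp
  have hQ0 : PowerSeries.coeff 0 (PowerSeries.map (Int.castRingHom ℂ) ramanujanQSeries) = 1 := by
    rw [PowerSeries.coeff_map, coeff_ramanujanQSeries]; simp
  have hc0 := hcoef 0
  have hS0 : PowerSeries.coeff 0 S = -(12⁻¹ : ℂ) := by
    rw [hS, map_sub, coeff_ramanujanTheta, PowerSeries.coeff_C_mul, PowerSeries.coeff_mul,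
      Finset.Nat.antidiagonal_zero, Finset.sum_singleton, hP0]
    norm_num
  rw [hS0, hQ0, mul_one] at hc0
  ext m
  have h := hcoef m
  rw [← hc0, hS, map_sub, coeff_ramanujanTheta, PowerSeries.coeff_C_mul] at h
  rw [map_sub, coeff_ofNat_mul_powerSeries, coeff_ramanujanTheta]
  linear_combination (12 : ℂ) * h

/-! ### The identity as functions on `ℍ` -/

/-- **Ramanujan's identity `∂₁E₂ = −E₄/12`** (i.e. `D E₂ = (E₂² − E₄)/12`; the quasi-modular one).
[cite: NesterenkoPhilippon2001, Ch. 3 §1 (2) (p. 27)] -/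
theorem serreDerivative_E₂_eq (τ : ℍ) : serreDerivative 1 E2 τ = -(12⁻¹ : ℂ) * E₄ τ := by
  refine (hasSum_serreDerivative_E₂ τ).unique ?_
  have h2 := (hasSum_E₄ τ).mul_left (-(12⁻¹ : ℂ))
  have hfun : (fun m : ℕ => PowerSeries.coeff m
      (ramanujanTheta (PowerSeries.map (Int.castRingHom ℂ) ramanujanPSeries)
          - PowerSeries.C (1 * 12⁻¹ : ℂ)
          * ((PowerSeries.map (Int.castRingHom ℂ) ramanujanPSeries) *
          (PowerSeries.map (Int.castRingHom ℂ) ramanujanPSeries))) *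
        cexp (2 * π * Complex.I * τ) ^ m) =
      fun m : ℕ => -(12⁻¹ : ℂ) * (PowerSeries.coeff m
          (PowerSeries.map (Int.castRingHom ℂ) ramanujanQSeries)
          * cexp (2 * π * Complex.I * τ) ^ m) := by
    funext m
    have h := congrArg (PowerSeries.coeff m) ramanujan_P_identity_complex
    rw [coeff_ofNat_mul_powerSeries, map_sub] at h
    rw [map_sub, PowerSeries.coeff_C_mul, coeff_ramanujanTheta]
    rw [coeff_ramanujanTheta] at h
    linear_combination (12⁻¹ * cexp (2 * π * Complex.I * τ) ^ m) * h
  rw [hfun]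
  exact h2

/-! ### Descent to `ℤ⟦X⟧`: the named fact `ramanujan1916_system` -/

/-- `θ` commutes with a change of coefficients. [folklore] -/
theorem ramanujanTheta_map {R S : Type*} [CommRing R] [CommRing S] (f : R →+* S)
    (φ : PowerSeries R) :
    PowerSeries.map f (ramanujanTheta φ) = ramanujanTheta (PowerSeries.map f φ) := by
  ext n
  simp [PowerSeries.coeff_map, coeff_ramanujanTheta]

/-- The coefficient map `ℤ⟦X⟧ → ℂ⟦X⟧` is injective. [folklore] -/
theorem powerSeries_map_int_complex_injective :
    Function.Injective (PowerSeries.map (Int.castRingHom ℂ)) := fun φ ψ h => by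
  ext n
  have := congrArg (PowerSeries.coeff n) h
  simpa only [PowerSeries.coeff_map, eq_intCast, Int.cast_inj] using this

/-- **Ramanujan's differential system DISCHARGED** (`ramanujan1916_system`, LNM 1752 Ch. 3 §1 (2)):
`12θP = P² − Q`, `3θQ = PQ − R`, `2θR = PR − Q²` in `ℤ⟦X⟧`, from the three identities over `ℂ`
(`ramanujan_P/Q/R_identity_complex`) along the injective coefficient map.
[cite: NesterenkoPhilippon2001, Ch. 3 §1 (2) (p. 27)] -/
theorem ramanujan1916_system_holds : ramanujan1916_system := by
  refine ⟨powerSeries_map_int_complex_injective ?_, powerSeries_map_int_complex_injective ?_,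
    powerSeries_map_int_complex_injective ?_⟩
  · rw [map_mul, map_ofNat, ramanujanTheta_map, map_sub, map_pow, ramanujan_P_identity_complex, sq]
  · rw [map_mul, map_ofNat, ramanujanTheta_map, map_sub, map_mul, ramanujan_Q_identity_complex]
  · rw [map_mul, map_ofNat, ramanujanTheta_map, map_sub, map_mul, map_pow,
      ramanujan_R_identity_complex, sq]

end Literature.Barriers.Schanuel

end
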